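import Mathlib.MeasureTheory.Function.Jacobian
import Mathlib.MeasureTheory.Constructions.Pi
import Mathlib.LinearAlgebra.Matrix.Determinant.Basic
import Mathlib.Analysis.Calculus.FDeriv.Mul
import Mathlib.Analysis.Calculus.FDeriv.Prod
import HarnessLib

/-!
# The quadratic substitution `y = (-x₂ x₀, -x₂ x₁, x₀² + x₁²)` on the upper half-space of `ℝ³`

The polynomial map `Q(x) = (-x₂ x₀, -x₂ x₁, x₀² + x₁²)` maps the open upper half-space
`{x₂ > 0}` of `ℝ³` minus its axis bijectively onto itself, with Jacobian determinant
`det DQ(x) = -2 x₂ (x₀² + x₁²)`. On directions it exchanges the polar angle `θ` (from the `x₂`-axis)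
with `π/2 - θ` (and rotates the azimuth by `π`); on radii it is quadratic. We prove the change of
variables (`MeasureTheory.lintegral_image_eq_lintegral_abs_det_fderiv_mul`)

`∫_{y₂ > 0} H(y) dy = ∫_{x₂ > 0} 2 x₂ (x₀² + x₁²) H(Q x) dx` (`lintegral_halfSpace_eq_lintegral_quadraticSwap`)

for every `H ≥ 0` on `Fin 3 → ℝ` (Lebesgue measure; no measurability is needed). Combined with polar coordinates this is the
substitution behind the exchange symmetry `v' ↔ v_*'` of the three-dimensional hard-sphere gain term
(the impact direction `ω` and the direction of `V - (V·ω) ω` carry the same measure `(V·ω)₊ dω` on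
`S²`), see `Literature/Analysis/UnboundedOperators/HardSphereGainExchange.lean`.

No new definitions are introduced; the map and its Jacobian matrix are written out in the statements.
-/

open MeasureTheory Set Filter
open scoped ENNReal Matrix

namespace Literature.MeasureTheory.Lebesgue

noncomputable section

/-! ### The derivative and its determinant -/

/-- The derivative of `Q(x) = (-x₂ x₀, -x₂ x₁, x₀² + x₁²)`: the Jacobian matrix
`[[-x₂, 0, -x₀], [0, -x₂, -x₁], [2x₀, 2x₁, 0]]`. [folklore] -/
theorem hasFDerivAt_quadraticSwap (x : Fin 3 → ℝ) :
    HasFDerivAt (fun x : Fin 3 → ℝ => ![-(x 2 * x 0), -(x 2 * x 1), x 0 ^ 2 + x 1 ^ 2])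
      (Matrix.toLin' !![-(x 2), 0, -(x 0); 0, -(x 2), -(x 1); 2 * x 0, 2 * x 1, 0]).toContinuousLinearMap
      x := by
  rw [hasFDerivAt_pi']
  intro i
  have h0 := hasFDerivAt_apply (𝕜 := ℝ) (0 : Fin 3) x
  have h1 := hasFDerivAt_apply (𝕜 := ℝ) (1 : Fin 3) x
  have h2 := hasFDerivAt_apply (𝕜 := ℝ) (2 : Fin 3) x
  have hsq : (fun x : Fin 3 → ℝ => x 0 ^ 2 + x 1 ^ 2) = fun x => x 0 * x 0 + x 1 * x 1 := by
    funext x; ring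
  fin_cases i
  · change HasFDerivAt (fun x : Fin 3 → ℝ => -(x 2 * x 0)) _ x
    refine ((h2.mul h0).neg).congr_fderiv ?_
    ext h
    simp [Matrix.toLin'_apply, dotProduct, Fin.sum_univ_three]
    ring
  · change HasFDerivAt (fun x : Fin 3 → ℝ => -(x 2 * x 1)) _ x
    refine ((h2.mul h1).neg).congr_fderiv ?_
    ext h
    simp [Matrix.toLin'_apply, dotProduct, Fin.sum_univ_three]
    ring
  · change HasFDerivAt (fun x : Fin 3 → ℝ => x 0 ^ 2 + x 1 ^ 2) _ x
    rw [hsq]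
    refine ((h0.mul h0).add (h1.mul h1)).congr_fderiv ?_
    ext h
    simp [Matrix.toLin'_apply, dotProduct, Fin.sum_univ_three]
    ring

/-- `det DQ(x) = -2 x₂ (x₀² + x₁²)`. [folklore] -/
theorem det_fderiv_quadraticSwap (x : Fin 3 → ℝ) :
    ((Matrix.toLin' !![-(x 2), 0, -(x 0); 0, -(x 2), -(x 1); 2 * x 0, 2 * x 1, 0]).toContinuousLinearMap).det
      = -(2 * x 2 * (x 0 ^ 2 + x 1 ^ 2)) := by
  rw [LinearMap.det_toContinuousLinearMap, LinearMap.det_toLin', Matrix.det_fin_three]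
  simp
  ring

/-! ### Injectivity and the image -/

/-- `Q` is injective on `{x₂ > 0, (x₀, x₁) ≠ 0}`: from `y = Q x` one recovers
`x₂ = |(y₀, y₁)| / √y₂` and `(x₀, x₁) = -(y₀, y₁) / x₂`. [folklore] -/
theorem injOn_quadraticSwap :
    InjOn (fun x : Fin 3 → ℝ => ![-(x 2 * x 0), -(x 2 * x 1), x 0 ^ 2 + x 1 ^ 2])
      {x | 0 < x 2 ∧ 0 < x 0 ^ 2 + x 1 ^ 2} := by
  intro x hx x' hx' h
  simp only [mem_setOf_eq] at hx hx'
  have e0 := congrFun h 0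
  have e1 := congrFun h 1
  have e2 := congrFun h 2
  simp only [Matrix.cons_val_zero, Matrix.cons_val_one, Matrix.cons_val, neg_inj] at e0 e1 e2
  -- `x₂² (x₀² + x₁²) = x₂'² (x₀'² + x₁'²)` and `x₀² + x₁² = x₀'² + x₁'²` give `x₂ = x₂'`
  have hsq : x 2 ^ 2 * (x 0 ^ 2 + x 1 ^ 2) = x' 2 ^ 2 * (x' 0 ^ 2 + x' 1 ^ 2) := by
    calc x 2 ^ 2 * (x 0 ^ 2 + x 1 ^ 2) = (x 2 * x 0) ^ 2 + (x 2 * x 1) ^ 2 := by ring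
      _ = (x' 2 * x' 0) ^ 2 + (x' 2 * x' 1) ^ 2 := by rw [e0, e1]
      _ = _ := by ring
  rw [e2] at hsq
  have h22 : x 2 ^ 2 = x' 2 ^ 2 := mul_right_cancel₀ hx'.2.ne' hsq
  have h2 : x 2 = x' 2 := by
    have := (pow_left_inj₀ hx.1.le hx'.1.le two_ne_zero).1 h22
    exact this
  rw [h2] at e0 e1
  have hx0 : x 0 = x' 0 := mul_left_cancel₀ hx'.1.ne' e0
  have hx1 : x 1 = x' 1 := mul_left_cancel₀ hx'.1.ne' e1
  funext i
  fin_cases i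
  · exact hx0
  · exact hx1
  · exact h2

/-- The image of `{x₂ > 0, (x₀, x₁) ≠ 0}` under `Q` is `{y₂ > 0, (y₀, y₁) ≠ 0}`. [folklore] -/
theorem image_quadraticSwap :
    (fun x : Fin 3 → ℝ => ![-(x 2 * x 0), -(x 2 * x 1), x 0 ^ 2 + x 1 ^ 2]) ''
        {x | 0 < x 2 ∧ 0 < x 0 ^ 2 + x 1 ^ 2} =
      {y | 0 < y 2 ∧ 0 < y 0 ^ 2 + y 1 ^ 2} := by
  ext y
  simp only [mem_image, mem_setOf_eq]
  constructor
  · rintro ⟨x, ⟨hx2, hx01⟩, rfl⟩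
    simp only [Matrix.cons_val_zero, Matrix.cons_val_one, Matrix.cons_val]
    refine ⟨hx01, ?_⟩
    have : (-(x 2 * x 0)) ^ 2 + (-(x 2 * x 1)) ^ 2 = x 2 ^ 2 * (x 0 ^ 2 + x 1 ^ 2) := by ring
    rw [this]
    positivity
  · rintro ⟨hy2, hy01⟩
    set ρ : ℝ := Real.sqrt (y 0 ^ 2 + y 1 ^ 2) with hρ
    set s : ℝ := Real.sqrt (y 2) with hs
    have hρ0 : 0 < ρ := Real.sqrt_pos.2 hy01
    have hs0 : 0 < s := Real.sqrt_pos.2 hy2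
    have hρ2 : ρ ^ 2 = y 0 ^ 2 + y 1 ^ 2 := Real.sq_sqrt hy01.le
    have hs2 : s ^ 2 = y 2 := Real.sq_sqrt hy2.le
    have hρne : ρ ≠ 0 := hρ0.ne'
    have hsne : s ≠ 0 := hs0.ne'
    have hc0 : ρ / s * (s * y 0 / ρ) = y 0 := by field_simp
    have hc1 : ρ / s * (s * y 1 / ρ) = y 1 := by field_simp
    have hc2 : (s * y 0 / ρ) ^ 2 + (s * y 1 / ρ) ^ 2 = y 2 := by
      rw [div_pow, div_pow, mul_pow, mul_pow, ← add_div, ← mul_add, hs2, ← hρ2]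
      field_simp
    have hpos2 : 0 < ρ / s := by positivity
    have hpos01 : 0 < (-(s * y 0 / ρ)) ^ 2 + (-(s * y 1 / ρ)) ^ 2 := by
      rw [neg_sq, neg_sq, hc2]; exact hy2
    refine ⟨![-(s * y 0 / ρ), -(s * y 1 / ρ), ρ / s], ⟨?_, ?_⟩, ?_⟩
    · simpa using hpos2
    · simpa using hpos01
    · funext i
      fin_cases i <;> simp [hc0, hc1, hc2]

/-! ### The change of variables -/

/-- The axis `{y₀ = 0}` is Lebesgue-null in `ℝ³`. [folklore] -/
theorem volume_setOf_apply_zero_eq_zero :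
    volume {y : Fin 3 → ℝ | y 0 = 0} = 0 := by
  rw [volume_pi]
  exact Measure.pi_hyperplane _ 0 0

/-- **The quadratic substitution on the upper half-space**: for every `H ≥ 0`,
`∫_{y₂ > 0} H(y) dy = ∫_{x₂ > 0} 2 x₂ (x₀² + x₁²) H(-x₂ x₀, -x₂ x₁, x₀² + x₁²) dx`.
[folklore] -/
theorem lintegral_halfSpace_eq_lintegral_quadraticSwap (H : (Fin 3 → ℝ) → ℝ≥0∞) :
    ∫⁻ y in {y : Fin 3 → ℝ | 0 < y 2}, H y =
      ∫⁻ x in {x : Fin 3 → ℝ | 0 < x 2}, ENNReal.ofReal (2 * x 2 * (x 0 ^ 2 + x 1 ^ 2)) *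
        H ![-(x 2 * x 0), -(x 2 * x 1), x 0 ^ 2 + x 1 ^ 2] := by
  have hsm : MeasurableSet {x : Fin 3 → ℝ | 0 < x 2 ∧ 0 < x 0 ^ 2 + x 1 ^ 2} :=
    (measurableSet_lt measurable_const (measurable_pi_apply 2)).inter
      (measurableSet_lt measurable_const (((measurable_pi_apply 0).pow_const 2).add
        ((measurable_pi_apply 1).pow_const 2)))
  -- Step 1: both sides live on `{x₂ > 0, (x₀, x₁) ≠ 0}`
  have hsub : {x : Fin 3 → ℝ | 0 < x 2 ∧ 0 < x 0 ^ 2 + x 1 ^ 2} ⊆ {x : Fin 3 → ℝ | 0 < x 2} :=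
    fun x hx => hx.1
  have hdiff : ({x : Fin 3 → ℝ | 0 < x 2} \ {x : Fin 3 → ℝ | 0 < x 2 ∧ 0 < x 0 ^ 2 + x 1 ^ 2}) ⊆
      {y : Fin 3 → ℝ | y 0 = 0} := by
    intro x hx
    simp only [Set.mem_sdiff, mem_setOf_eq, not_and, not_lt] at hx
    have h := hx.2 hx.1
    have h0 : x 0 ^ 2 = 0 := by nlinarith [sq_nonneg (x 0), sq_nonneg (x 1)]
    exact pow_eq_zero_iff (n := 2) (by norm_num) |>.1 h0
  have hnull : volume ({x : Fin 3 → ℝ | 0 < x 2} \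
      {x : Fin 3 → ℝ | 0 < x 2 ∧ 0 < x 0 ^ 2 + x 1 ^ 2}) = 0 :=
    measure_mono_null hdiff volume_setOf_apply_zero_eq_zero
  have hrestr : ∀ G : (Fin 3 → ℝ) → ℝ≥0∞, ∫⁻ y in {y : Fin 3 → ℝ | 0 < y 2}, G y =
      ∫⁻ y in {x : Fin 3 → ℝ | 0 < x 2 ∧ 0 < x 0 ^ 2 + x 1 ^ 2}, G y := fun G => by
    rw [← sdiff_union_of_subset hsub, lintegral_union hsm disjoint_sdiff_left,
      setLIntegral_measure_zero _ _ hnull, zero_add]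
  rw [hrestr, hrestr]
  conv_lhs => rw [← image_quadraticSwap]
  -- Step 2: the change of variables
  rw [lintegral_image_eq_lintegral_abs_det_fderiv_mul volume hsm
    (fun x _ => (hasFDerivAt_quadraticSwap x).hasFDerivWithinAt) injOn_quadraticSwap]
  refine setLIntegral_congr_fun hsm fun x hx => ?_
  rw [det_fderiv_quadraticSwap, abs_neg, abs_of_nonneg]
  have := hx.1.le
  positivity

end

end Literature.MeasureTheory.Lebesgue
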